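import Mathlib
import Summits.Schanuel.Schanuel.Theses.RigidCore
import Summits.Schanuel.Schanuel.Theorems.AclSubsetLogFreeCore.Negative.LogFreeCoreObjects
import Summits.Schanuel.Schanuel.Theorems.RigidCoreAclSubsetLogFreeCoreOfEac
import Summits.Schanuel.Schanuel.Theorems.RigidCoreAclSubsetLogFreeCoreRealiseCopy
import Summits.Schanuel.Schanuel.Theorems.RigidCoreAclSubsetLogFreeCoreCaseI
import Summits.Schanuel.Schanuel.Theorems.RigidCoreAclSubsetLogFreeCoreDoubleBase
import Summits.Schanuel.Schanuel.Theorems.RigidCoreAclSubsetLogFreeCoreDoubleRank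
import Summits.Schanuel.Schanuel.Theorems.RigidCoreAclSubsetLogFreeCoreDoubleModel
import Summits.Schanuel.Schanuel.Theorems.RigidCoreAclSubsetLogFreeCoreHullToCore
import Summits.Schanuel.Schanuel.Theorems.RigidCoreAclSubsetLogFreeCoreCaseIITransfer
import Summits.Schanuel.Schanuel.Theorems.RigidCoreAclSubsetLogFreeCoreCaseIIReduce
import Summits.Schanuel.Schanuel.Theorems.RigidCoreAclSubsetLogFreeCoreCaseIICore
import Literature.NumberTheory.Transcendental.Zilber
import Literature.NumberTheory.Transcendental.ZilberField
import Literature.NumberTheory.Transcendental.ZilberFieldQuasiminimal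
import Literature.NumberTheory.Transcendental.ZilberFieldAutomorphisms
import Literature.NumberTheory.Transcendental.GammaIsoCross
import Literature.NumberTheory.Transcendental.GammaFields

/-!
# `(A)` under Zilber's conjecture: `ZilberConjecture → RigidCore.AclSubsetLogFreeCore`
(line `eac-extends-core-automorphisms` of crux stmt-Schanuel-0968, assembled by leads 0, 1, c1, c2)

The CONDITIONAL theorem delivered by the line: if `ℂ_exp` is a Zilber field (Zilber's conjecture,
`Literature.NumberTheory.Transcendental.ZilberConjecture = IsZilberField ℂ`; it implies EAC and —
honest ceiling, refuter `DoublingCalibration` — also the Schanuel property, i.e. the summit), then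
every element of a finite `∅`-definable subset of `ℂ_exp` lies in the log-free core `C_EA`
(`RigidCore.AclSubsetLogFreeCore`, crux (A)).  This is the crux docstring's claim "(A) is implied by
Zilber's conjecture + L1" with L1 (`Fix(Aut_E(ecl ∅)) ⊆ C_EA` under ZC) PROVED on the way:

* `(A) ⟸ EAC ∧ (A₀)` — `aclSubsetLogFreeCore_of_eac_of_coreFixedField` (lead 0, p72771);
* `(A₀) ⟸ ZC` — `coreFixedField_logFree_of_isZilberField` below: Case I (doubling = double base +
  rank + countable model + realisation, hull-to-core; leads 1, c1) and Case II (transfer to the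
  countable core + reduction by minimal hulls and branch-shifting automorphisms + the core
  "difference algebra of a branch shift"; leads c1, c2), all landed under `Theorems/`.
-/

noncomputable section

set_option linter.dupNamespace false

open Set
open Literature.ModelTheory.ExponentialFields Literature.ModelTheory.ExponentialFields.ExponentialRing
open Literature.NumberTheory.Transcendental Literature.NumberTheory.Transcendental.GammaField
open Summit.Schanuel.Schanuel.Theorems.AclSubsetLogFreeCore.Negative

namespace Summit.Schanuel.Schanuel.Theorems.RigidCore

namespace OfZilber

/-- **The doubling principle** (double base + rank + countable model + realisation): under Zilber's
conjecture a free strong extension `e` of `X = ℚ·2πi + ℚc ◁ ℂ` of predimension `0` has a Γ-isomorphic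
partner `e'` over `c`, again strong, in general position with respect to `e` modulo `X`.
[cite: BaysKirby2018ANT, Thm 6.9, Lemma 8.3] -/
theorem doubling (hZ : IsZilberField ℂ) (τ : ℂ) (hτ : τ = 2 * ↑Real.pi * Complex.I) {N k : ℕ}
    (c : Fin N → ℂ) (e : Fin k → ℂ)
    (hX : IsStrong (Submodule.span ℚ ({τ} : Set ℂ) ⊔ Submodule.span ℚ (range c)))
    (hW : IsStrong (Submodule.span ℚ ({τ} : Set ℂ) ⊔
      Submodule.span ℚ (range (Fin.append c e))))
    (hlin : LinIndepOver (Submodule.span ℚ ({τ} : Set ℂ) ⊔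
      Submodule.span ℚ (range c)) e)
    (hδ : predim (Submodule.span ℚ ({τ} : Set ℂ) ⊔ Submodule.span ℚ (range c))
      (Submodule.span ℚ (range e)) = 0)
    (hfree : ∀ m : Fin k → ℤ, m ≠ 0 →
      (∑ j, (m j : ℚ) • e j) ∉ acl (gens (Submodule.span ℚ ({τ} : Set ℂ) ⊔
        Submodule.span ℚ (range c))) ∧
      Complex.exp (∑ j, (m j : ℚ) • e j) ∉ acl (gens (Submodule.span ℚ ({τ} : Set ℂ) ⊔
        Submodule.span ℚ (range c)))) :
    ∃ e' : Fin k → ℂ,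
      IsGammaIsoTw₂ (RingEquiv.refl (fieldOf (Submodule.span ℚ ({τ} : Set ℂ))))
        (Fin.append c e) (Fin.append c e') ∧
      IsStrong (Submodule.span ℚ ({τ} : Set ℂ) ⊔
        Submodule.span ℚ (range (Fin.append c e'))) ∧
      ∀ q : Fin k → ℚ, q ≠ 0 →
        (∑ j, q j • (e' j - e j)) ∉
          Submodule.span ℚ ({τ} : Set ℂ) ⊔ Submodule.span ℚ (range c) := by
  obtain ⟨F, hFW, K, _, _, D, θ, t, j₁, j₂, hK, hjτ, hagree, hD, hθ, hstrong, hnov⟩ :=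
    stub_doubleBase τ hτ c e hX hlin hfree
  have hrank := stub_doubleRank τ c e hX hlin hδ F hFW K D θ t j₁ j₂ hK hjτ hagree hD hθ
  obtain ⟨M, _, _, _, τ₁, σ₀, c₁, e₁, e₂, hker, hτ₁, hσ₀, h₁, h₂, hsM, hδM, hnew⟩ :=
    stub_doubleModel τ c e hX hlin hδ F hFW K D θ t j₁ j₂ hK hjτ hagree hD hθ hstrong hnov hrank
  exact stub_realiseCopy hZ τ hτ M τ₁ hker hτ₁ σ₀ hσ₀ c₁ e₁ e₂ c e h₁ h₂ hsM hδM hnew hX hW hδ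

/-- **Case II** assembled: transfer to the countable core, reduction, core claim. -/
theorem caseII (hZ : IsZilberField ℂ) (τ : ℂ) (hτ : τ = 2 * ↑Real.pi * Complex.I) :
    ∀ a ∈ ecl (∅ : Set ℂ),
      a ∈ (sInf {K : IntermediateField ℚ ℂ | (2 * ↑Real.pi * Complex.I : ℂ) ∈ K ∧
          (∀ w ∈ K, Complex.exp w ∈ K) ∧ (∀ w : ℂ, IsAlgebraic K w → w ∈ K) ∧
          (∀ w : ℂ, Complex.exp w ∈ K → w ∈ K)} : IntermediateField ℚ ℂ) →
      (∀ g : ℂ → ℂ, IsEIsoOn g (ecl (∅ : Set ℂ)) (ecl (∅ : Set ℂ)) → g a = a) →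
        a ∈ (logFreeCore : Set ℂ) :=
  stub_caseII_transfer hZ τ hτ fun E _ _ _ hE huniv τE hkerE => by
    haveI := hE.isAlgClosed
    -- the kernel generator is non-zero: the standard kernel is generated by a transcendental
    have hτE : τE ≠ 0 := by
      obtain ⟨τ₀, hτ₀, hker₀⟩ := hE.hasStandardKernel
      intro h0
      have hmem : τ₀ ∈ expKernel E := by rw [hker₀]; exact AddSubgroup.mem_zmultiples τ₀
      rw [hkerE, h0, AddSubgroup.zmultiples_zero_eq_bot, AddSubgroup.mem_bot] at hmem
      exact hτ₀ (hmem ▸ isAlgebraic_zero)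
    exact stub_caseII_reduce hE huniv τE hkerE fun X hτX hXfg hXs ℓ hℓexp hℓ U s v hU hvA hXclosed θ
        hθexp hθX q hq hθℓ hθU =>
      stub_caseII_core τE hkerE hτE X hτX hXfg hXs ℓ hℓexp hℓ U v hU hvA hXclosed θ hθexp hθX q hq
        hθℓ hθU

/-- **The residue (A₀) under Zilber's conjecture** (Case I + Case II): the fixed field of
`Aut_E(ecl ∅)` lies in the log-free core (the crux docstring's "L1").  Stated over a variable
`τ = 2πi` (the literal inside types is expensive to unify). -/
theorem coreFixedField_logFree_of_isZilberField (hZ : IsZilberField ℂ) (τ : ℂ)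
    (hτ : τ = 2 * ↑Real.pi * Complex.I) :
    ∀ a ∈ ecl (∅ : Set ℂ),
      (∀ g : ℂ → ℂ, IsEIsoOn g (ecl (∅ : Set ℂ)) (ecl (∅ : Set ℂ)) → g a = a) →
        a ∈ (logFreeCore : Set ℂ) :=
  fun a ha hfix =>
    caseII hZ τ hτ a ha
      (stub_caseI hZ τ hτ (fun hiso hs hs' => hullToCore hZ τ hτ hiso hs hs')
        (fun c e => doubling hZ τ hτ c e) a ha hfix)
      hfix

end OfZilber

/-- **`(A)` under Zilber's conjecture (as `IsZilberField ℂ`)**: the crux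
`RigidCore.AclSubsetLogFreeCore` follows from `IsZilberField ℂ`, through the landed transfer theorem
`aclSubsetLogFreeCore_of_eac_of_coreFixedField` ((A) ⟸ EAC ∧ (A₀)), EAC being
`hZ.isStronglyExpAlgClosed.isExpAlgClosed` and (A₀) `OfZilber.coreFixedField_logFree_of_isZilberField`.
CONDITIONAL on Zilber's conjecture (which contains the Schanuel property). -/
theorem aclSubsetLogFreeCore_of_isZilberField (hZ : IsZilberField ℂ) :
    Summit.Schanuel.Schanuel.Theses.RigidCore.AclSubsetLogFreeCore :=
  aclSubsetLogFreeCore_of_eac_of_coreFixedField hZ.isStronglyExpAlgClosed.isExpAlgClosed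
    (OfZilber.coreFixedField_logFree_of_isZilberField hZ (2 * ↑Real.pi * Complex.I) rfl)

/-- **`(A)` under Zilber's conjecture** (`ZilberConjecture = IsZilberField ℂ`, named conjecture of
`Literature/NumberTheory/Transcendental/Zilber.lean`): a CONDITIONAL proof of the crux
`RigidCore.AclSubsetLogFreeCore`. -/
theorem AclSubsetLogFreeCore_of_zilberConjecture (hZ : ZilberConjecture) :
    Summit.Schanuel.Schanuel.Theses.RigidCore.AclSubsetLogFreeCore :=
  aclSubsetLogFreeCore_of_isZilberField hZ

end Summit.Schanuel.Schanuel.Theorems.RigidCore
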